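import Literature.Barriers.Parity.SiegelZeroQuadraticPolynomialsProgressions
import Mathlib.Analysis.SpecialFunctions.Pow.Asymptotics
import HarnessLib

/-!
# Granville–Mollin's Theorem 4: limits and parameter choices for the final assembly

Topic `Literature/Barriers/Parity`, last preparatory layer of the proof of
`Literature.Barriers.Parity.GranvilleMollin2000_thm4` (Granville–Mollin, *Rabinowitsch revisited*,
Acta Arith. 96 (2000), Theorem 4). Everything is PROVED; no definition is introduced.

* `tendsto_relErrorTail` — the tail `G(ε, K', K₁; q)` of `relError_le`
  (`SiegelZeroQuadraticPolynomialsRelError.lean`) tends to `0` as `q → ∞` (powers of `log q` against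
  powers of `q`, Mathlib's `isLittleO_log_rpow_rpow_atTop`, and `1/log q`, `1/log log q`,
  `1/√(log log q) → 0`).
* `exists_eps_exp_le` — for `A, ε₀ > 0` there is `0 < ε ≤ 1/100` with `A e^{−5/ε} ≤ ε₀` (the choice
  of the sieving exponent `y = q^ε`).
* `two_pow_floor_le`, `lt_two_pow_floor_add_one` — with `M = ⌊4 log y/log 2⌋`, `2^M ≤ y⁴ < 2^{M+1}`.
* `polyPrimeCount_rabinowitsch_eq_zero` — for `q ≡ 7 (mod 8)`, `q ≥ 15` (`d = −q ≡ 1 (mod 8)`), every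
  value `f_d(n) = n² + n + (1 + q)/4` is even and `> 2`, so `π_{f_d}(N) = 0` (the trivial case of
  Theorem 4, where also `ϱ_d = 0`, `gmRho_eq_zero`).

[cite: GranvilleMollin2000, Theorem 4, §6B]
-/

noncomputable section

open Filter Real Polynomial
open scoped Topology
open Literature.NumberTheory.Sieve

namespace Literature.Barriers.Parity

/-! ### Limits -/

/-- `log x ^ n / x ^ s → 0` (`s > 0`, natural `n`), from Mathlib's `isLittleO_log_rpow_rpow_atTop`.
[folklore] -/
theorem tendsto_log_pow_div_rpow (n : ℕ) {s : ℝ} (hs : 0 < s) :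
    Tendsto (fun x : ℝ => Real.log x ^ n / x ^ s) atTop (𝓝 0) := by
  have h := (isLittleO_log_rpow_rpow_atTop (n : ℝ) hs).tendsto_div_nhds_zero
  refine h.congr' ?_
  filter_upwards [eventually_ge_atTop (1 : ℝ)] with x hx
  rw [Real.rpow_natCast]

/-- `1/log x → 0`, `1/(log x)² → 0`, `1/log log x → 0`, `1/√(log log x) → 0` as `x → ∞`. [folklore] -/
theorem tendsto_inv_log : Tendsto (fun x : ℝ => 1 / Real.log x) atTop (𝓝 0) := by
  have h := tendsto_log_atTop.inv_tendsto_atTop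
  refine h.congr' (Eventually.of_forall fun x => ?_)
  simp [one_div]

/-- `1/(log x)² → 0`. [folklore] -/
theorem tendsto_inv_log_sq : Tendsto (fun x : ℝ => 1 / Real.log x ^ 2) atTop (𝓝 0) := by
  have h := ((tendsto_pow_atTop two_ne_zero).comp tendsto_log_atTop).inv_tendsto_atTop
  refine h.congr' (Eventually.of_forall fun x => ?_)
  simp [one_div, Function.comp]

/-- `1/log log x → 0`. [folklore] -/
theorem tendsto_inv_loglog : Tendsto (fun x : ℝ => 1 / Real.log (Real.log x)) atTop (𝓝 0) := by
  have h := (tendsto_log_atTop.comp tendsto_log_atTop).inv_tendsto_atTop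
  refine h.congr' (Eventually.of_forall fun x => ?_)
  simp [one_div, Function.comp]

/-- `1/√(log log x) → 0`. [folklore] -/
theorem tendsto_inv_sqrt_loglog : Tendsto (fun x : ℝ => 1 / Real.sqrt (Real.log (Real.log x))) atTop (𝓝 0) := by
  have h := ((tendsto_rpow_atTop (by norm_num : (0 : ℝ) < 1 / 2)).comp
    (tendsto_log_atTop.comp tendsto_log_atTop)).inv_tendsto_atTop
  refine h.congr' (Eventually.of_forall fun x => ?_)
  simp [one_div, Function.comp, Real.sqrt_eq_rpow]

/-- `1/x^ε → 0` (`ε > 0`). [folklore] -/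
theorem tendsto_inv_rpow {ε : ℝ} (hε : 0 < ε) : Tendsto (fun x : ℝ => 1 / x ^ ε) atTop (𝓝 0) := by
  have h := (tendsto_rpow_atTop hε).inv_tendsto_atTop
  refine h.congr' (Eventually.of_forall fun x => ?_)
  simp [one_div]

/-- **The tail of the relative error tends to `0`** (the function `G` of `relError_le`, as a
function of `q`, `L = log q`). [cite: GranvilleMollin2000, §6B] -/
theorem tendsto_relErrorTail (ε K' K₁ C : ℝ) (hε : 0 < ε) (hε1 : ε ≤ 1 / 100) :
    Tendsto (fun q : ℝ =>
      Real.exp 33 * K₁ ^ 2 * ε ^ 2 * Real.log q ^ 4 / q ^ (5 : ℝ) +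
        2 * Real.exp 25 * K₁ ^ 2 * Real.log q ^ 2 * q ^ (ε / 2) / q ^ (10 : ℝ) +
        (132 + 192 * Real.exp 8 + 4 * (1 + C)) * K' * Real.exp 25 *
          (1 / Real.log q ^ 2 + K₁ ^ 2 / Real.log (Real.log q)) +
        (1 + C) * Real.exp 1 * K₁ * (1 / ε + 2) / Real.sqrt (Real.log (Real.log q)) +
        17 * Real.exp 33 * ε ^ 2 * K₁ ^ 2 * Real.log q ^ 4 / q ^ ((1 : ℝ) / 4) +
        48 * (1 + C) * K' * ε * Real.sqrt (Real.exp 1 * (2 * Real.exp (17 + 12 / Real.log 2))) *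
          Real.exp (25 / 2) * (1 / Real.log q + K₁ / Real.sqrt (Real.log (Real.log q))) / Real.log 2 +
        2 * K₁ / (ε * Real.sqrt (Real.log (Real.log q))) + 32 / q ^ ε) atTop (𝓝 0) := by
  -- the eight pieces
  have h1 : Tendsto (fun q : ℝ => Real.exp 33 * K₁ ^ 2 * ε ^ 2 * Real.log q ^ 4 / q ^ (5 : ℝ)) atTop (𝓝 0) := by
    have := (tendsto_log_pow_div_rpow 4 (by norm_num : (0 : ℝ) < 5)).const_mul (Real.exp 33 * K₁ ^ 2 * ε ^ 2)
    rw [mul_zero] at this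
    refine this.congr' (Eventually.of_forall fun q => ?_); beta_reduce; ring
  have h2 : Tendsto (fun q : ℝ => 2 * Real.exp 25 * K₁ ^ 2 * Real.log q ^ 2 * q ^ (ε / 2) / q ^ (10 : ℝ)) atTop (𝓝 0) := by
    have hs : (0 : ℝ) < 10 - ε / 2 := by linarith
    have := (tendsto_log_pow_div_rpow 2 hs).const_mul (2 * Real.exp 25 * K₁ ^ 2)
    rw [mul_zero] at this
    refine this.congr' ?_
    filter_upwards [eventually_gt_atTop (0 : ℝ)] with q hq
    rw [Real.rpow_sub hq, div_div_eq_mul_div]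
    ring
  have h3 : Tendsto (fun q : ℝ => (132 + 192 * Real.exp 8 + 4 * (1 + C)) * K' * Real.exp 25 *
      (1 / Real.log q ^ 2 + K₁ ^ 2 / Real.log (Real.log q))) atTop (𝓝 0) := by
    have ha := tendsto_inv_log_sq
    have hb := tendsto_inv_loglog.const_mul (K₁ ^ 2)
    rw [mul_zero] at hb
    have := (ha.add hb).const_mul ((132 + 192 * Real.exp 8 + 4 * (1 + C)) * K' * Real.exp 25)
    rw [add_zero, mul_zero] at this
    refine this.congr' (Eventually.of_forall fun q => ?_); beta_reduce; ring
  have h4 : Tendsto (fun q : ℝ => (1 + C) * Real.exp 1 * K₁ * (1 / ε + 2) / Real.sqrt (Real.log (Real.log q))) atTop (𝓝 0) := by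
    have := tendsto_inv_sqrt_loglog.const_mul ((1 + C) * Real.exp 1 * K₁ * (1 / ε + 2))
    rw [mul_zero] at this
    refine this.congr' (Eventually.of_forall fun q => ?_); beta_reduce; ring
  have h5 : Tendsto (fun q : ℝ => 17 * Real.exp 33 * ε ^ 2 * K₁ ^ 2 * Real.log q ^ 4 / q ^ ((1 : ℝ) / 4)) atTop (𝓝 0) := by
    have := (tendsto_log_pow_div_rpow 4 (by norm_num : (0 : ℝ) < 1 / 4)).const_mul (17 * Real.exp 33 * ε ^ 2 * K₁ ^ 2)
    rw [mul_zero] at this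
    refine this.congr' (Eventually.of_forall fun q => ?_); beta_reduce; ring
  have h6 : Tendsto (fun q : ℝ => 48 * (1 + C) * K' * ε * Real.sqrt (Real.exp 1 * (2 * Real.exp (17 + 12 / Real.log 2))) *
      Real.exp (25 / 2) * (1 / Real.log q + K₁ / Real.sqrt (Real.log (Real.log q))) / Real.log 2) atTop (𝓝 0) := by
    have ha := tendsto_inv_log
    have hb := tendsto_inv_sqrt_loglog.const_mul K₁
    rw [mul_zero] at hb
    have := (ha.add hb).const_mul (48 * (1 + C) * K' * ε *
      Real.sqrt (Real.exp 1 * (2 * Real.exp (17 + 12 / Real.log 2))) * Real.exp (25 / 2) / Real.log 2)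
    rw [add_zero, mul_zero] at this
    refine this.congr' (Eventually.of_forall fun q => ?_); beta_reduce; ring
  have h7 : Tendsto (fun q : ℝ => 2 * K₁ / (ε * Real.sqrt (Real.log (Real.log q)))) atTop (𝓝 0) := by
    have := tendsto_inv_sqrt_loglog.const_mul (2 * K₁ / ε)
    rw [mul_zero] at this
    refine this.congr' (Eventually.of_forall fun q => ?_); beta_reduce
    field_simp
  have h8 : Tendsto (fun q : ℝ => 32 / q ^ ε) atTop (𝓝 0) := by
    have := (tendsto_inv_rpow hε).const_mul 32
    rw [mul_zero] at this
    refine this.congr' (Eventually.of_forall fun q => ?_); beta_reduce; ring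
  have := ((((((h1.add h2).add h3).add h4).add h5).add h6).add h7).add h8
  simpa using this

/-! ### Parameter choices -/

/-- **Choice of the sieving exponent**: for `A, ε₀ > 0` there is `ε` with `0 < ε ≤ 1/100` and
`A e^{−5/ε} ≤ ε₀`. [folklore] -/
theorem exists_eps_exp_le {A ε₀ : ℝ} (hA : 0 < A) (hε₀ : 0 < ε₀) :
    ∃ ε : ℝ, 0 < ε ∧ ε ≤ 1 / 100 ∧ A * Real.exp (-(5 / ε)) ≤ ε₀ := by
  set t : ℝ := |Real.log (ε₀ / A)| + 1 with ht
  have ht0 : 0 < t := by positivity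
  refine ⟨min (1 / 100) (5 / t), lt_min (by norm_num) (by positivity), min_le_left _ _, ?_⟩
  have hε : 0 < min (1 / 100 : ℝ) (5 / t) := lt_min (by norm_num) (by positivity)
  have h5 : t ≤ 5 / min (1 / 100 : ℝ) (5 / t) := by
    rw [le_div_iff₀ hε]
    calc t * min (1 / 100 : ℝ) (5 / t) ≤ t * (5 / t) := mul_le_mul_of_nonneg_left (min_le_right _ _) ht0.le
      _ = 5 := by field_simp
  have hlog : Real.log (ε₀ / A) ≥ -(5 / min (1 / 100 : ℝ) (5 / t)) := by
    have := neg_abs_le (Real.log (ε₀ / A))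
    linarith
  calc A * Real.exp (-(5 / min (1 / 100 : ℝ) (5 / t))) ≤ A * Real.exp (Real.log (ε₀ / A)) :=
        mul_le_mul_of_nonneg_left (Real.exp_le_exp.mpr hlog) hA.le
    _ = ε₀ := by rw [Real.exp_log (div_pos hε₀ hA)]; field_simp

/-- **The dyadic exponent**: with `M = ⌊4 log y/log 2⌋` (`y ≥ 1`), `2^M ≤ y⁴`. [folklore] -/
theorem two_pow_floor_le {y : ℝ} (hy : 1 ≤ y) :
    (2 : ℝ) ^ ⌊4 * Real.log y / Real.log 2⌋₊ ≤ y ^ 4 := by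
  have hlog2 : 0 < Real.log 2 := Real.log_pos one_lt_two
  have hy0 : 0 < y := by linarith
  have h0 : 0 ≤ 4 * Real.log y / Real.log 2 := by
    have := Real.log_nonneg hy; positivity
  have h1 : (⌊4 * Real.log y / Real.log 2⌋₊ : ℝ) * Real.log 2 ≤ 4 * Real.log y := by
    have := Nat.floor_le h0
    rwa [le_div_iff₀ hlog2] at this
  have h2 : Real.log ((2 : ℝ) ^ ⌊4 * Real.log y / Real.log 2⌋₊) ≤ Real.log (y ^ 4) := by
    rw [Real.log_pow, Real.log_pow]; push_cast; linarith
  exact (Real.log_le_log_iff (by positivity) (by positivity)).mp h2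

/-- With `M = ⌊4 log y/log 2⌋` (`y > 0`), `y⁴ < 2^{M+1}`. [folklore] -/
theorem lt_two_pow_floor_add_one {y : ℝ} (hy : 0 < y) :
    y ^ 4 < (2 : ℝ) ^ (⌊4 * Real.log y / Real.log 2⌋₊ + 1) := by
  have hlog2 : 0 < Real.log 2 := Real.log_pos one_lt_two
  have h1 : 4 * Real.log y < ((⌊4 * Real.log y / Real.log 2⌋₊ : ℝ) + 1) * Real.log 2 := by
    have := Nat.lt_floor_add_one (4 * Real.log y / Real.log 2)
    rwa [div_lt_iff₀ hlog2] at this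
  have h2 : Real.log (y ^ 4) < Real.log ((2 : ℝ) ^ (⌊4 * Real.log y / Real.log 2⌋₊ + 1)) := by
    rw [Real.log_pow, Real.log_pow]; push_cast; linarith
  exact (Real.log_lt_log_iff (by positivity) (by positivity)).mp h2

/-! ### The trivial case `d ≡ 1 (mod 8)` -/

/-- **For `q ≡ 7 (mod 8)`, `q ≥ 15` (`d = −q ≡ 1 (mod 8)`), `π_{f_d}(N) = 0`**: every value
`f_d(n) = n(n+1) + (1 + q)/4` is even and at least `4`. [cite: GranvilleMollin2000, Theorem 4 (the case of a fixed prime divisor)] -/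
theorem polyPrimeCount_rabinowitsch_eq_zero {d : ℤ} {q : ℕ} (hdq : d = -(q : ℤ)) (hq8 : q % 8 = 7)
    (hq15 : 15 ≤ q) (N : ℕ) : polyPrimeCount ![rabinowitschPoly d] N = 0 := by
  have hpos := rabinowitsch_eval_pos hdq (by omega : 3 ≤ q)
  rw [polyPrimeCount_single_eq_card _ hpos, Finset.card_eq_zero, Finset.filter_eq_empty_iff]
  intro n _ h
  rw [rabinowitsch_eval_eq hdq] at h
  -- `n(n+1) = 2m`, `(1+q)/4 = 2(j+1)` with `q = 8j + 7`
  obtain ⟨m, hm⟩ := Int.even_mul_succ_self (n : ℤ)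
  obtain ⟨j, hj⟩ : ∃ j : ℕ, q = 8 * j + 7 := ⟨q / 8, by omega⟩
  have hj1 : 1 ≤ j := by omega
  have hA : (1 + (q : ℤ)) / 4 = 2 * ((j : ℤ) + 1) := by
    rw [hj]; push_cast
    rw [show (1 : ℤ) + (8 * (j : ℤ) + 7) = (2 * (j + 1)) * 4 by ring, Int.mul_ediv_cancel _ (by norm_num)]
  have hmn : (n : ℤ) ^ 2 + n = m + m := by rw [← hm]; ring
  have hval : (n : ℤ) ^ 2 + n + (1 + (q : ℤ)) / 4 = 2 * (m + j + 1) := by rw [hA]; linarith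
  rw [hval, Int.natAbs_mul] at h
  refine Nat.not_prime_mul (by decide) ?_ h
  have hn0 : (0 : ℤ) ≤ (n : ℤ) ^ 2 + n := by positivity
  have hj1' : (1 : ℤ) ≤ j := by exact_mod_cast hj1
  omega

end Literature.Barriers.Parity
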